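import Mathlib
import HarnessLib
import Summits.QuantumFields.YangMills.Theorems.ConvexGribovBodyContinuumLegGivenGapStubUclOfCsclB

/-!
# `ContinuumLegGivenGap` (stmt-QuantumFields-15828), line `Sketch` (reshape 15): `stub_uclOfCscl` — (UCL) is DERIVED

Support file for the crux item stmt-QuantumFields-15828 (registered glue stub `stub_uclOfCscl` of line `Sketch`,
reshape 15). Route ParabolicTrajectory's k-uniform rate-free SPATIAL clustering `UCL r sch` (the E4 input of its
one-field OS packaging) follows from conjuncts the line's UV stub already carries — (CSCL) Cauchy–Schwarz clustering of
the canonical scheme in the TIME direction, (ROT) asymptotic proper-rotation invariance, (UUVB) the uniform-threshold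
E0′ bounds, (PVG) polynomial volume growth (hence the landed translation half of E1 `stub_transl`) — together with
`β_k → ∞` (hence the landed (ARP) `stub_arp` via odd-torus reflection positivity) and the three landed glue statements
(`stub_asympCS`, `stub_smallRotation`, `stub_bddSlabDensity`, hypotheses here, discharged in the skeleton):

* `ucl_main` — arities `n, m ≥ 1`: density of the `x^{i+1}`-bounded slab-ordered real product tensors in the ordered
  wedge (`i+1` a coordinate with `a^{i+1} ≠ 0`), `t`-UNIFORM control of the two cross terms by the asymptotic
  Cauchy–Schwarz inequality (part A, `trunc_pair_le`), and the tilted main term on the spans (part B, `span_main`);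
* `stub_uclOfCscl` — the registered stub: k-uniform E0′ constants from (UUVB) (`norm_curvDistribution_le_of_uuvb`),
  degenerate arities by part A (`ucl_zero_left/right`), `H` unique (`eq_appendTensor_of_isAppendTensorOf`). [folklore]
-/

noncomputable section

namespace Summit.QuantumFields.YangMills.Theorems.ContinuumLegGivenGap

open scoped SchwartzMap ComplexConjugate
open Filter Topology MeasureTheory
open Literature.MathematicalPhysics.QuantumFieldTheory Literature.MathematicalPhysics.QuantumLattice
  Literature.MathematicalPhysics.AQFT Literature.Probability.LatticeModels
open Summit.QuantumFields.YangMills.Cruxes.ContinuumLimitOnTrajectory.TwoOrbitSynchronisation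
  (curvDistribution curvCLM curvCLM_apply curvDistribution_sub curvDistribution_zero curvDistribution_smul
   curvDistribution_add canon UUVB UVB ARP UCL AsympTransl PolyVolumeGrowth PlaqIdx stub_transl
   torusSlabRP_of_tendsto exists_coord_ne_zero)
open Summit.QuantumFields.YangMills.Cruxes.ContinuumLimitOnTrajectory.TwoOrbitSynchronisation.Transl
  (norm_curvDistribution_le_of_uuvb)
open Summit.QuantumFields.YangMills.Cruxes.LatticeGapOnTrajectory.OrbitKantorovichFiniteSize.Transfer
  (eq_appendTensor_of_isAppendTensorOf)

section Main

variable {G : Type} [Group G] [TopologicalSpace G] [IsTopologicalGroup G] [CompactSpace G]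
  [MeasurableSpace G] [BorelSpace G] (r : LatticeRep G) (sch : SpeciesScheme (YMSpecies G))

/-! ## §1 Kinematics of the truncated pairing -/

/-- **Sesquilinear splitting of the truncated pairing**: with `Tr(Φ, Ψ) = 𝓓(ΘΦ* ⊗ T_vΨ) − 𝓓(ΘΦ*)𝓓(Ψ)`,
`Tr(P + F₁, Q + G₁) = Tr(P, Q) + Tr(F₁, Q + G₁) + Tr(P, G₁)`. [folklore] -/
theorem trunc_split (k : ℕ) {n m : ℕ} (P F₁ : 𝓢((Fin n → EuclideanSpace ℝ (Fin 4)), ℂ))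
    (Q G₁ : 𝓢((Fin m → EuclideanSpace ℝ (Fin 4)), ℂ)) (v : EuclideanSpace ℝ (Fin 4)) :
    curvDistribution r sch k (n + m) ((osAdjoint (P + F₁)).appendTensor (translateMulti v (Q + G₁))) -
        curvDistribution r sch k n (osAdjoint (P + F₁)) * curvDistribution r sch k m (Q + G₁) =
      (curvDistribution r sch k (n + m) ((osAdjoint P).appendTensor (translateMulti v Q)) -
          curvDistribution r sch k n (osAdjoint P) * curvDistribution r sch k m Q) +
      ((curvDistribution r sch k (n + m) ((osAdjoint F₁).appendTensor (translateMulti v (Q + G₁))) -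
          curvDistribution r sch k n (osAdjoint F₁) * curvDistribution r sch k m (Q + G₁)) +
        (curvDistribution r sch k (n + m) ((osAdjoint P).appendTensor (translateMulti v G₁)) -
          curvDistribution r sch k n (osAdjoint P) * curvDistribution r sch k m G₁)) := by
  simp only [osAdjoint_add, SchwartzMap.appendTensor_add_left, SchwartzMap.appendTensor_add_right, map_add,
    curvDistribution_add]
  ring

/-! ## §2 The main case `n, m ≥ 1` -/

/-- **The error budget** (pure real bookkeeping of `ucl_main`). [folklore] -/
theorem ucl_budget {M₁ C₁ C₂ nFP nG nP nGQ X₁ X₂ A₀ η₂ ε : ℝ}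
    (hnFP : 0 ≤ nFP) (hnGQ : 0 ≤ nGQ) (hA₀ : 0 < A₀) (hη₂ : 0 < η₂) (hη₂1 : η₂ ≤ 1)
    (hη₂ε : η₂ ≤ ε / 32) (hη₂sq : A₀ * Real.sqrt η₂ ≤ ε / 32) (hPA : nP < A₀)
    (herr : nFP * Real.sqrt (nG + 1) + X₁ + (A₀ * Real.sqrt nGQ + X₂) < ε / 8)
    (h1 : M₁ ≤ ε / 8 + ε / 8) (h2 : C₁ ≤ nFP * Real.sqrt (nG + η₂) + η₂ + X₁)
    (h3 : C₂ ≤ nP * Real.sqrt (nGQ + η₂) + η₂ + X₂) :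
    M₁ + (C₁ + C₂) ≤ ε := by
  have e0 : Real.sqrt (nG + η₂) ≤ Real.sqrt (nG + 1) := Real.sqrt_le_sqrt (by linarith)
  have h2' : C₁ ≤ nFP * Real.sqrt (nG + 1) + η₂ + X₁ := by nlinarith [e0, hnFP]
  have e1 : Real.sqrt (nGQ + η₂) ≤ Real.sqrt nGQ + Real.sqrt η₂ := by
    rw [Real.sqrt_le_left (by positivity)]
    nlinarith [Real.sq_sqrt hnGQ, Real.sq_sqrt hη₂.le, Real.sqrt_nonneg nGQ, Real.sqrt_nonneg η₂]
  have e2 : nP * Real.sqrt (nGQ + η₂) ≤ A₀ * (Real.sqrt nGQ + Real.sqrt η₂) :=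
    mul_le_mul hPA.le e1 (Real.sqrt_nonneg _) hA₀.le
  have h3' : C₂ ≤ A₀ * Real.sqrt nGQ + X₂ + (ε / 32 + ε / 32) := by nlinarith [e2, hη₂sq, hη₂ε]
  nlinarith [h1, h2', h3', herr, hη₂ε]

/-- **Good approximants** (the density step of `ucl_main`): for time-ordered `F, G'`, a coordinate `i+1` and
`ε > 0`, there are `P`, `Q` in the `ℂ`-spans of the `x^{i+1}`-bounded slab-ordered real product tensors and positive
slack constants `A₀, η₂` such that the `t`-uniform cross-term majorant of `trunc_pair_le` at `(F − P, G')` and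
`(P, G' − Q)` is below `ε/8` (bounded ordered-wedge density `hC`, continuity of `osAdjoint`, `appendTensor` and the
Schwartz norms). [folklore] -/
theorem exists_good_approximants
    (hC : ∀ (n : ℕ) (i : Fin 4) (F : 𝓢((Fin n → EuclideanSpace ℝ (Fin 4)), ℂ)), IsTimeOrdered F →
      F ∈ closure ((Submodule.span ℂ {P : 𝓢((Fin n → EuclideanSpace ℝ (Fin 4)), ℂ) |
          ∃ (p : Fin n → 𝓢(EuclideanSpace ℝ (Fin 4), ℝ)) (ρ : ℝ),
            IsTensorOf P (fun l => ofRealTest (p l)) ∧ IsSlabOrdered p ∧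
              ∀ l, tsupport (p l : EuclideanSpace ℝ (Fin 4) → ℝ) ⊆ {x | |x i| ≤ ρ}} :
        Submodule ℂ (𝓢((Fin n → EuclideanSpace ℝ (Fin 4)), ℂ))) :
        Set (𝓢((Fin n → EuclideanSpace ℝ (Fin 4)), ℂ))))
    (K : ℕ → ℝ) (s : ℕ) {n m : ℕ} (i : Fin 3)
    {F : 𝓢((Fin n → EuclideanSpace ℝ (Fin 4)), ℂ)} {G' : 𝓢((Fin m → EuclideanSpace ℝ (Fin 4)), ℂ)}
    (hF : IsTimeOrdered F) (hG : IsTimeOrdered G') {ε : ℝ} (hε : 0 < ε) :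
    ∃ (P : 𝓢((Fin n → EuclideanSpace ℝ (Fin 4)), ℂ)) (Q : 𝓢((Fin m → EuclideanSpace ℝ (Fin 4)), ℂ)) (A₀ η₂ : ℝ),
      P ∈ Submodule.span ℂ {P : 𝓢((Fin n → EuclideanSpace ℝ (Fin 4)), ℂ) |
          ∃ (p : Fin n → 𝓢(EuclideanSpace ℝ (Fin 4), ℝ)) (ρ : ℝ),
            IsTensorOf P (fun l => ofRealTest (p l)) ∧ IsSlabOrdered p ∧
              ∀ l, tsupport (p l : EuclideanSpace ℝ (Fin 4) → ℝ) ⊆ {x | |x i.succ| ≤ ρ}} ∧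
      Q ∈ Submodule.span ℂ {Q : 𝓢((Fin m → EuclideanSpace ℝ (Fin 4)), ℂ) |
          ∃ (q : Fin m → 𝓢(EuclideanSpace ℝ (Fin 4), ℝ)) (ρ : ℝ),
            IsTensorOf Q (fun l => ofRealTest (q l)) ∧ IsSlabOrdered q ∧
              ∀ l, tsupport (q l : EuclideanSpace ℝ (Fin 4) → ℝ) ⊆ {x | |x i.succ| ≤ ρ}} ∧
      0 < A₀ ∧ 0 < η₂ ∧ η₂ ≤ 1 ∧ η₂ ≤ ε / 32 ∧ A₀ * Real.sqrt η₂ ≤ ε / 32 ∧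
      Real.sqrt (K (n + n) * schwartzNorm ((n + n) * s) ((osAdjoint P).appendTensor P)) < A₀ ∧
      Real.sqrt (K (n + n) * schwartzNorm ((n + n) * s) ((osAdjoint (F - P)).appendTensor (F - P))) *
            Real.sqrt (K (m + m) * schwartzNorm ((m + m) * s) ((osAdjoint G').appendTensor G') + 1) +
          K n * schwartzNorm (n * s) (osAdjoint (F - P)) * (K m * schwartzNorm (m * s) G') +
        (A₀ * Real.sqrt (K (m + m) * schwartzNorm ((m + m) * s) ((osAdjoint (G' - Q)).appendTensor (G' - Q))) +
          K n * schwartzNorm (n * s) (osAdjoint P) * (K m * schwartzNorm (m * s) (G' - Q))) < ε / 8 := by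
  -- continuity of the Cauchy–Schwarz majorants
  have hNc : ∀ l : ℕ, Continuous fun Φ : 𝓢((Fin l → EuclideanSpace ℝ (Fin 4)), ℂ) =>
      K (l + l) * schwartzNorm ((l + l) * s) ((osAdjoint Φ).appendTensor Φ) := fun l =>
    continuous_const.mul ((continuous_schwartzNorm _).comp
      (continuous_appendTensor.comp (continuous_osAdjoint.prodMk continuous_id)))
  -- the slack constants
  set A₀ : ℝ := Real.sqrt (K (n + n) * schwartzNorm ((n + n) * s) ((osAdjoint F).appendTensor F)) + 1 with hA₀
  have hA₀pos : 0 < A₀ := by positivity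
  set η₂ : ℝ := min 1 (min (ε / 32) ((ε / (32 * A₀)) ^ 2)) with hη₂
  have hη₂pos : 0 < η₂ := lt_min one_pos (lt_min (by positivity) (by positivity))
  have hη₂sq : A₀ * Real.sqrt η₂ ≤ ε / 32 := by
    have h : Real.sqrt η₂ ≤ ε / (32 * A₀) := by
      rw [Real.sqrt_le_left (by positivity)]
      exact (min_le_right _ _).trans (min_le_right _ _)
    calc A₀ * Real.sqrt η₂ ≤ A₀ * (ε / (32 * A₀)) := mul_le_mul_of_nonneg_left h hA₀pos.le
      _ = ε / 32 := by field_simp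
  -- the `t`-uniform cross-term majorant, continuous and vanishing at `(F, G')`
  let err : 𝓢((Fin n → EuclideanSpace ℝ (Fin 4)), ℂ) × 𝓢((Fin m → EuclideanSpace ℝ (Fin 4)), ℂ) → ℝ := fun PQ =>
    Real.sqrt (K (n + n) * schwartzNorm ((n + n) * s) ((osAdjoint (F - PQ.1)).appendTensor (F - PQ.1))) *
          Real.sqrt (K (m + m) * schwartzNorm ((m + m) * s) ((osAdjoint G').appendTensor G') + 1) +
        K n * schwartzNorm (n * s) (osAdjoint (F - PQ.1)) * (K m * schwartzNorm (m * s) G') +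
      (A₀ * Real.sqrt (K (m + m) * schwartzNorm ((m + m) * s) ((osAdjoint (G' - PQ.2)).appendTensor (G' - PQ.2))) +
        K n * schwartzNorm (n * s) (osAdjoint PQ.1) * (K m * schwartzNorm (m * s) (G' - PQ.2)))
  have herr : Continuous err := by
    refine ((((Real.continuous_sqrt.comp ((hNc n).comp (continuous_const.sub continuous_fst))).mul
      continuous_const).add ((continuous_const.mul ((continuous_schwartzNorm _).comp
        (continuous_osAdjoint.comp (continuous_const.sub continuous_fst)))).mul continuous_const))).add
      ((continuous_const.mul (Real.continuous_sqrt.comp ((hNc m).comp (continuous_const.sub continuous_snd)))).add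
        ((continuous_const.mul ((continuous_schwartzNorm _).comp (continuous_osAdjoint.comp continuous_fst))).mul
          (continuous_const.mul ((continuous_schwartzNorm _).comp (continuous_const.sub continuous_snd)))))
  have hzero_tensor : ∀ (l : ℕ) (X : 𝓢((Fin l → EuclideanSpace ℝ (Fin 4)), ℂ)),
      (0 : 𝓢((Fin l → EuclideanSpace ℝ (Fin 4)), ℂ)).appendTensor X = 0 := by
    intro l X
    have h := SchwartzMap.appendTensor_smul_left (0 : ℂ) (0 : 𝓢((Fin l → EuclideanSpace ℝ (Fin 4)), ℂ)) X
    simpa only [zero_smul] using h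
  have hosAdjoint_zero : ∀ l, osAdjoint (0 : 𝓢((Fin l → EuclideanSpace ℝ (Fin 4)), ℂ)) = 0 := by
    intro l
    have h := osAdjoint_smul (0 : ℂ) (0 : 𝓢((Fin l → EuclideanSpace ℝ (Fin 4)), ℂ))
    simpa only [smul_zero, map_zero, zero_smul] using h
  have herr0 : err (F, G') = 0 := by
    simp [err, hosAdjoint_zero, hzero_tensor, schwartzNorm_zero_aux]
  -- the open set of good approximants meets span × span
  have hsqc : Continuous fun P : 𝓢((Fin n → EuclideanSpace ℝ (Fin 4)), ℂ) =>
      Real.sqrt (K (n + n) * schwartzNorm ((n + n) * s) ((osAdjoint P).appendTensor P)) :=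
    Real.continuous_sqrt.comp (hNc n)
  let U : Set (𝓢((Fin n → EuclideanSpace ℝ (Fin 4)), ℂ) × 𝓢((Fin m → EuclideanSpace ℝ (Fin 4)), ℂ)) :=
    {PQ | err PQ < ε / 8 ∧ Real.sqrt (K (n + n) * schwartzNorm ((n + n) * s) ((osAdjoint PQ.1).appendTensor PQ.1)) < A₀}
  have hU : IsOpen U := (isOpen_lt herr continuous_const).inter (isOpen_lt (hsqc.comp continuous_fst) continuous_const)
  have hFG : (F, G') ∈ U := by
    refine ⟨?_, ?_⟩
    · show err (F, G') < ε / 8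
      rw [herr0]; positivity
    · show Real.sqrt (K (n + n) * schwartzNorm ((n + n) * s) ((osAdjoint F).appendTensor F)) < A₀
      rw [hA₀]; exact lt_add_one _
  have hcl : (F, G') ∈ closure
      (((Submodule.span ℂ {P : 𝓢((Fin n → EuclideanSpace ℝ (Fin 4)), ℂ) |
          ∃ (p : Fin n → 𝓢(EuclideanSpace ℝ (Fin 4), ℝ)) (ρ : ℝ), IsTensorOf P (fun l => ofRealTest (p l)) ∧
            IsSlabOrdered p ∧ ∀ l, tsupport (p l : EuclideanSpace ℝ (Fin 4) → ℝ) ⊆ {x | |x i.succ| ≤ ρ}} :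
          Submodule ℂ _) : Set _) ×ˢ
        ((Submodule.span ℂ {Q : 𝓢((Fin m → EuclideanSpace ℝ (Fin 4)), ℂ) |
          ∃ (q : Fin m → 𝓢(EuclideanSpace ℝ (Fin 4), ℝ)) (ρ : ℝ), IsTensorOf Q (fun l => ofRealTest (q l)) ∧
            IsSlabOrdered q ∧ ∀ l, tsupport (q l : EuclideanSpace ℝ (Fin 4) → ℝ) ⊆ {x | |x i.succ| ≤ ρ}} :
          Submodule ℂ _) : Set _)) := by
    rw [closure_prod_eq]; exact ⟨hC n i.succ F hF, hC m i.succ G' hG⟩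
  obtain ⟨⟨P, Q⟩, ⟨hPQerr, hPA⟩, hP, hQ⟩ := mem_closure_iff.1 hcl _ hU hFG
  refine ⟨P, Q, A₀, η₂, hP, hQ, hA₀pos, hη₂pos, min_le_left _ _, (min_le_right _ _).trans (min_le_left _ _), hη₂sq,
    hPA, ?_⟩
  dsimp only [err] at hPQerr
  exact hPQerr

/-- **(UCL) for arities `n, m ≥ 1`.** Under the hypotheses of the assembly (abstract asymptotic Cauchy–Schwarz `hA`,
small rotations `hB`, bounded ordered-wedge density `hC`, (ARP), the translation half of E1, (ROT) on
`curvDistribution`, (CSCL) at rate `Δ > 0`, a k-uniform E0′ bound `K`), for time-ordered `F, G'`, a spatial `a ≠ 0` and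
`ε > 0` there is `t₀` such that for every `t ≥ t₀`, EVENTUALLY in `k`,
`‖𝓓_{n+m}(ΘF* ⊗ T_{ta}G') − 𝓓ₙ(ΘF*) 𝓓ₘ(G')‖ ≤ ε`: choose the coordinate `i+1` with `a^{i+1} ≠ 0`, good approximants
`(P, Q)` (`exists_good_approximants`), the tilted main term on the spans (`span_main`, part B) for `(P, Q)`, and the
`t`-uniform cross-term bounds (`trunc_pair_le`, part A) for `(F − P, G')`, `(P, G' − Q)`. [folklore] -/
theorem ucl_main
    (hA : ∀ (A B B' D : ℕ → ℂ),
      (∃ C : ℝ, ∀ᶠ k in atTop, ‖A k‖ ≤ C ∧ ‖B k‖ ≤ C ∧ ‖B' k‖ ≤ C ∧ ‖D k‖ ≤ C) →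
      (∀ (μ : ℂ) (ε : ℝ), 0 < ε → ∀ᶠ k in atTop,
        -ε ≤ (A k + μ * B k + (starRingEnd ℂ) μ * B' k + (starRingEnd ℂ) μ * μ * D k).re ∧
          |(A k + μ * B k + (starRingEnd ℂ) μ * B' k + (starRingEnd ℂ) μ * μ * D k).im| ≤ ε) →
      ∀ η : ℝ, 0 < η → ∀ᶠ k in atTop, ‖B k‖ ≤ Real.sqrt ‖A k‖ * Real.sqrt ‖D k‖ + η)
    (hB : ∀ (i : Fin 3) (σ ρ g : ℝ), σ ≠ 0 → 0 < ρ → 0 < g →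
      ∃ (R : EuclideanSpace ℝ (Fin 4) ≃ₗᵢ[ℝ] EuclideanSpace ℝ (Fin 4)) (c s : ℝ),
        LinearMap.det (R.toLinearEquiv : EuclideanSpace ℝ (Fin 4) →ₗ[ℝ] EuclideanSpace ℝ (Fin 4)) = 1 ∧
        (∀ x : EuclideanSpace ℝ (Fin 4), R x 0 = c * x 0 + s * x i.succ) ∧
        (∀ x : EuclideanSpace ℝ (Fin 4), R.symm x 0 = c * x 0 - s * x i.succ) ∧
        0 < σ * s ∧ 0 < c ∧ c ≤ 1 ∧ (1 - c) * ρ ≤ g ∧ |s| * ρ ≤ g)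
    (hC : ∀ (n : ℕ) (i : Fin 4) (F : 𝓢((Fin n → EuclideanSpace ℝ (Fin 4)), ℂ)), IsTimeOrdered F →
      F ∈ closure ((Submodule.span ℂ {P : 𝓢((Fin n → EuclideanSpace ℝ (Fin 4)), ℂ) |
          ∃ (p : Fin n → 𝓢(EuclideanSpace ℝ (Fin 4), ℝ)) (ρ : ℝ),
            IsTensorOf P (fun l => ofRealTest (p l)) ∧ IsSlabOrdered p ∧
              ∀ l, tsupport (p l : EuclideanSpace ℝ (Fin 4) → ℝ) ⊆ {x | |x i| ≤ ρ}} :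
        Submodule ℂ (𝓢((Fin n → EuclideanSpace ℝ (Fin 4)), ℂ))) :
        Set (𝓢((Fin n → EuclideanSpace ℝ (Fin 4)), ℂ))))
    (hARP : ARP r sch) (hTr : AsympTransl r sch)
    (hROT : ∀ (p : ℕ) (F : 𝓢((Fin p → EuclideanSpace ℝ (Fin 4)), ℂ)), IsOffDiagonal F →
      ∀ R : EuclideanSpace ℝ (Fin 4) ≃ₗᵢ[ℝ] EuclideanSpace ℝ (Fin 4),
        LinearMap.det (R.toLinearEquiv : EuclideanSpace ℝ (Fin 4) →ₗ[ℝ] EuclideanSpace ℝ (Fin 4)) = 1 →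
          Tendsto (fun k : ℕ => curvDistribution r sch k p (linActMulti R F) - curvDistribution r sch k p F)
            atTop (𝓝 0))
    {Δ : ℝ} (hΔ : 0 < Δ) (hCS : SpeciesScheme.HasCSClustering r (canon r sch) Δ)
    {K : ℕ → ℝ} {s : ℕ} (hK : ∀ p, 0 ≤ K p)
    (hb : ∀ᶠ k in atTop, ∀ (p : ℕ) (F : 𝓢((Fin p → EuclideanSpace ℝ (Fin 4)), ℂ)), IsOffDiagonal F →
      ‖curvDistribution r sch k p F‖ ≤ K p * schwartzNorm (p * s) F)
    {n m : ℕ} (hn : n ≠ 0) (hm : m ≠ 0)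
    {F : 𝓢((Fin n → EuclideanSpace ℝ (Fin 4)), ℂ)} {G' : 𝓢((Fin m → EuclideanSpace ℝ (Fin 4)), ℂ)}
    (hF : IsTimeOrdered F) (hG : IsTimeOrdered G') {a : EuclideanSpace ℝ (Fin 4)} (ha0 : a 0 = 0) (ha : a ≠ 0)
    {ε : ℝ} (hε : 0 < ε) :
    ∃ t₀ : ℝ, ∀ t : ℝ, t₀ ≤ t → ∀ᶠ k in atTop,
      ‖curvDistribution r sch k (n + m) ((osAdjoint F).appendTensor (translateMulti (t • a) G')) -
          curvDistribution r sch k n (osAdjoint F) * curvDistribution r sch k m G'‖ ≤ ε := by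
  -- the coordinate to tilt, the approximants
  obtain ⟨i₀, hi₀, hai₀⟩ := exists_coord_ne_zero ha0 ha
  obtain ⟨i, rfl⟩ := Fin.exists_succ_eq.2 hi₀
  obtain ⟨P, Q, A₀, η₂, hP, hQ, hA₀pos, hη₂pos, hη₂1, hη₂ε, hη₂sq, hPA, hPQerr⟩ :=
    exists_good_approximants hC K s i hF hG hε
  have hPt : IsTimeOrdered P := isTimeOrdered_of_mem_span (mem_span_slabOrderedProducts_of_mem_span_bdd hP)
  have hQt : IsTimeOrdered Q := isTimeOrdered_of_mem_span (mem_span_slabOrderedProducts_of_mem_span_bdd hQ)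
  -- time-ordering is stable under subtraction (a support condition)
  have hsub : ∀ {l : ℕ} {A B : 𝓢((Fin l → EuclideanSpace ℝ (Fin 4)), ℂ)}, IsTimeOrdered A → IsTimeOrdered B →
      IsTimeOrdered (A - B) := by
    intro l A B hA' hB' x hx
    rw [sub_eq_add_neg] at hx
    rcases tsupport_add (A : (Fin l → EuclideanSpace ℝ (Fin 4)) → ℂ) ((-B : 𝓢((Fin l → _), ℂ)) : (Fin l → _) → ℂ)
      hx with h | h
    · exact hA' h
    · refine hB' ?_
      have e : ((-B : 𝓢((Fin l → EuclideanSpace ℝ (Fin 4)), ℂ)) : (Fin l → EuclideanSpace ℝ (Fin 4)) → ℂ) =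
          fun y => (-1 : ℂ) • (B : (Fin l → EuclideanSpace ℝ (Fin 4)) → ℂ) y := by
        funext y; simp
      rw [e] at h
      exact tsupport_smul_subset_right (fun _ => (-1 : ℂ)) _ h
  have hFPt : IsTimeOrdered (F - P) := hsub hF hPt
  have hGQt : IsTimeOrdered (G' - Q) := hsub hG hQt
  -- the main term on the spans and its decay time
  obtain ⟨σ₀, M, hσ₀, hM, hmain⟩ := span_main r sch hB hTr hROT hCS hK hb hn hm hP hQ ha0 hai₀ (η := ε / 8)
    (by positivity)
  have hlim : Tendsto (fun t : ℝ => Real.exp (-Δ * (σ₀ * t)) * M) atTop (𝓝 0) := by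
    have h1 : Tendsto (fun t : ℝ => Δ * (σ₀ * t)) atTop atTop :=
      Tendsto.const_mul_atTop hΔ (Tendsto.const_mul_atTop hσ₀ tendsto_id)
    have h2 := (Real.tendsto_exp_neg_atTop_nhds_zero.comp h1).mul_const M
    rw [zero_mul] at h2
    refine h2.congr fun t => ?_
    simp only [Function.comp_apply, neg_mul]
  obtain ⟨t₁, ht₁⟩ := Filter.eventually_atTop.1 (hlim.eventually (ge_mem_nhds (show 0 < ε / 8 by positivity)))
  refine ⟨max t₁ 0, fun t ht => ?_⟩
  have ht0 : 0 ≤ t := (le_max_right _ _).trans ht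
  have hta0 : (t • a) 0 = 0 := by rw [PiLp.smul_apply, ha0, smul_zero]
  have hexpM : Real.exp (-Δ * (σ₀ * t)) * M ≤ ε / 8 := ht₁ t ((le_max_left _ _).trans ht)
  filter_upwards [hmain t ht0, trunc_pair_le r sch hA hARP hTr hK hb hFPt hG hta0 hη₂pos,
    trunc_pair_le r sch hA hARP hTr hK hb hPt hGQt hta0 hη₂pos] with k h1 h2 h3
  have key := trunc_split r sch k P (F - P) Q (G' - Q) (t • a)
  rw [show P + (F - P) = F by abel, show Q + (G' - Q) = G' by abel] at key
  rw [key]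
  refine (norm_add_le _ _).trans ((add_le_add le_rfl (norm_add_le _ _)).trans ?_)
  exact ucl_budget (Real.sqrt_nonneg _) (mul_nonneg (hK _) (schwartzNorm_nonneg _ _)) hA₀pos hη₂pos hη₂1 hη₂ε
    hη₂sq hPA hPQerr (by linarith) h2 h3

/-! ## §3 The registered stub -/

/-- `stub_uclOfCscl` — **(UCL) from (CSCL), (ROT), (UUVB), (PVG), `β_k → ∞` and the three landed glue statements**
(registered glue stub of stmt-QuantumFields-15828, line `Sketch`, reshape 15): route ParabolicTrajectory's k-uniform
rate-free spatial clustering `UCL r sch` of the canonical curvature distributions. The first three hypotheses are the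
statements of the landed `stub_asympCS`, `stub_smallRotation`, `stub_bddSlabDensity` verbatim; `β_k → ∞` gives (ARP)
(`stub_arp`, `torusSlabRP_of_tendsto`, `uvb_of_uuvb`), (PVG) ∧ (UUVB) the translation half of E1 (`stub_transl`) and
the k-uniform E0′ bound (`norm_curvDistribution_le_of_uuvb`); arities `n, m ≥ 1` by `ucl_main` (tilt of the spatial
direction into Euclidean time), `n = 0` by `ucl_zero_left`, `m = 0` by `ucl_zero_right`; `H` is unique
(`eq_appendTensor_of_isAppendTensorOf`). [folklore] -/
theorem stub_uclOfCscl :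
    ∀ (G : Type) [Group G] [TopologicalSpace G] [IsTopologicalGroup G] [CompactSpace G]
      [MeasurableSpace G] [BorelSpace G] (r : LatticeRep G) (sch : SpeciesScheme (YMSpecies G)),
      (∀ (A B B' D : ℕ → ℂ),
        (∃ C : ℝ, ∀ᶠ k in atTop, ‖A k‖ ≤ C ∧ ‖B k‖ ≤ C ∧ ‖B' k‖ ≤ C ∧ ‖D k‖ ≤ C) →
        (∀ (μ : ℂ) (ε : ℝ), 0 < ε → ∀ᶠ k in atTop,
          -ε ≤ (A k + μ * B k + (starRingEnd ℂ) μ * B' k + (starRingEnd ℂ) μ * μ * D k).re ∧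
            |(A k + μ * B k + (starRingEnd ℂ) μ * B' k + (starRingEnd ℂ) μ * μ * D k).im| ≤ ε) →
        ∀ η : ℝ, 0 < η → ∀ᶠ k in atTop, ‖B k‖ ≤ Real.sqrt ‖A k‖ * Real.sqrt ‖D k‖ + η) →
      (∀ (i : Fin 3) (σ ρ g : ℝ), σ ≠ 0 → 0 < ρ → 0 < g →
        ∃ (R : EuclideanSpace ℝ (Fin 4) ≃ₗᵢ[ℝ] EuclideanSpace ℝ (Fin 4)) (c s : ℝ),
          LinearMap.det (R.toLinearEquiv : EuclideanSpace ℝ (Fin 4) →ₗ[ℝ] EuclideanSpace ℝ (Fin 4)) = 1 ∧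
          (∀ x : EuclideanSpace ℝ (Fin 4), R x 0 = c * x 0 + s * x i.succ) ∧
          (∀ x : EuclideanSpace ℝ (Fin 4), R.symm x 0 = c * x 0 - s * x i.succ) ∧
          0 < σ * s ∧ 0 < c ∧ c ≤ 1 ∧ (1 - c) * ρ ≤ g ∧ |s| * ρ ≤ g) →
      (∀ (n : ℕ) (i : Fin 4) (F : SchwartzMap (Fin n → EuclideanSpace ℝ (Fin 4)) ℂ), IsTimeOrdered F →
        F ∈ closure ((Submodule.span ℂ {P : SchwartzMap (Fin n → EuclideanSpace ℝ (Fin 4)) ℂ |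
            ∃ (p : Fin n → SchwartzMap (EuclideanSpace ℝ (Fin 4)) ℝ) (ρ : ℝ),
              IsTensorOf P (fun l => ofRealTest (p l)) ∧ IsSlabOrdered p ∧
                ∀ l, tsupport (p l : EuclideanSpace ℝ (Fin 4) → ℝ) ⊆ {x | |x i| ≤ ρ}} :
          Submodule ℂ (SchwartzMap (Fin n → EuclideanSpace ℝ (Fin 4)) ℂ)) :
          Set (SchwartzMap (Fin n → EuclideanSpace ℝ (Fin 4)) ℂ))) →
      Tendsto sch.β atTop atTop →
      Summit.QuantumFields.YangMills.Cruxes.ContinuumLimitOnTrajectory.TwoOrbitSynchronisation.UUVB r sch →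
      Summit.QuantumFields.YangMills.Cruxes.ContinuumLimitOnTrajectory.TwoOrbitSynchronisation.PolyVolumeGrowth sch →
      (∀ (p : ℕ) (F : SchwartzMap (Fin p → EuclideanSpace ℝ (Fin 4)) ℂ), IsOffDiagonal F →
        ∀ R : EuclideanSpace ℝ (Fin 4) ≃ₗᵢ[ℝ] EuclideanSpace ℝ (Fin 4),
          LinearMap.det (R.toLinearEquiv : EuclideanSpace ℝ (Fin 4) →ₗ[ℝ] EuclideanSpace ℝ (Fin 4)) = 1 →
            Tendsto (fun k : ℕ =>
              Summit.QuantumFields.YangMills.Cruxes.ContinuumLimitOnTrajectory.TwoOrbitSynchronisation.curvDistribution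
                  r sch k p (linActMulti R F) -
                Summit.QuantumFields.YangMills.Cruxes.ContinuumLimitOnTrajectory.TwoOrbitSynchronisation.curvDistribution
                  r sch k p F) atTop (𝓝 0)) →
      (∃ Δ₁ : ℝ, 0 < Δ₁ ∧ SpeciesScheme.HasCSClustering r
        (Summit.QuantumFields.YangMills.Cruxes.ContinuumLimitOnTrajectory.TwoOrbitSynchronisation.canon r sch) Δ₁) →
      Summit.QuantumFields.YangMills.Cruxes.ContinuumLimitOnTrajectory.TwoOrbitSynchronisation.UCL r sch := by
  intro G _ _ _ _ _ _ r sch hA hB hC hAF hUU hPVG hROT hCS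
  obtain ⟨Δ₁, hΔ₁, hCS⟩ := hCS
  have hTr : AsympTransl r sch := stub_transl G r sch hPVG hUU
  have hUVB : UVB r sch :=
    Summit.QuantumFields.YangMills.Cruxes.ContinuumLimitOnTrajectory.TwoOrbitSynchronisation.uvb_of_uuvb r sch hUU
  have hARP : ARP r sch :=
    Summit.QuantumFields.YangMills.Cruxes.ContinuumLimitOnTrajectory.TwoOrbitSynchronisation.stub_arp G r sch
      (torusSlabRP_of_tendsto r sch hAF) hUU hUVB
  obtain ⟨s, α, β, hb⟩ := norm_curvDistribution_le_of_uuvb r sch hUU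
  -- the k-uniform E0′ bound with a nonnegative constant
  set K : ℕ → ℝ := fun p => |(Fintype.card PlaqIdx : ℝ) ^ p * (α * (p.factorial : ℝ) ^ β)|
  have hb' : ∀ᶠ k in atTop, ∀ (p : ℕ) (F : 𝓢((Fin p → EuclideanSpace ℝ (Fin 4)), ℂ)), IsOffDiagonal F →
      ‖curvDistribution r sch k p F‖ ≤ K p * schwartzNorm (p * s) F := by
    refine hb.mono fun k hk p F hF => (hk p F hF).trans ?_
    rw [← mul_assoc]
    exact mul_le_mul_of_nonneg_right (le_abs_self _) (schwartzNorm_nonneg _ _)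
  intro n m F G' hF hG' a ha0 ha ε hε
  rcases Nat.eq_zero_or_pos n with rfl | hn
  · -- `n = 0`: translation non-invariance of `𝓓ₘ`, killed by the translation half of E1
    refine ⟨0, fun t _ H hH => ?_⟩
    filter_upwards [ucl_zero_left r sch hTr F hG'.isOffDiagonal (t • a) hε] with k hk
    simpa only [eq_appendTensor_of_isAppendTensorOf hH] using hk
  rcases Nat.eq_zero_or_pos m with rfl | hm
  · -- `m = 0`: the truncated quantity vanishes identically
    refine ⟨0, fun t _ H hH => Eventually.of_forall fun k => ?_⟩
    rw [eq_appendTensor_of_isAppendTensorOf hH, ucl_zero_right, norm_zero]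
    exact hε.le
  · obtain ⟨t₀, ht₀⟩ := ucl_main r sch hA hB hC hARP hTr hROT hΔ₁ hCS (fun p => abs_nonneg _) hb' hn.ne' hm.ne' hF hG'
      ha0 ha hε
    refine ⟨t₀, fun t ht H hH => ?_⟩
    rw [eq_appendTensor_of_isAppendTensorOf hH]
    exact ht₀ t ht

end Main

end Summit.QuantumFields.YangMills.Theorems.ContinuumLegGivenGap

end
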